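import Summits.ResolutionOfSingularities.ResolutionOfSingularities.Theorems.HilbertSamuelEliminationSigmaMaxModificationsCorridor3SigmaMenuSurfacePointStep
import Literature.AlgebraicGeometry.Resolution.StrictNormalCrossingsLabels
import Literature.AlgebraicGeometry.Resolution.EtaleVanishingIdeal
import Literature.AlgebraicGeometry.Resolution.StalkIdealLemmas
import Literature.AlgebraicGeometry.Resolution.MarkedIdealsLemmas
import Literature.AlgebraicGeometry.Resolution.RegularSystemOfParameters
import HarnessLib

/-!
# [OURS · L1 W4.2] σ-LAYER PHASE B′ — `Corridor3SigmaSurfaceReadyOfSnc`: WHEN DOES `ℓ = 0` MAKE THE SURFACE READY? — list-level simple normal crossings of the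
# filtered traces (`SncListOn` = Literature `HasSNC`) FROM set-level snc of their union (`ℓ(E, D) = 0`) PLUS «every trace is locally a PRIME principal ideal»
# PLUS «distinct traces have distinct stalks where they meet»; hence `ReadyTSOfRecord` from `ℓ = 0` and exactly these conditions — the EXHAUSTIVENESS BRIDGE of the
# (P1*) case rule (what the badness count `M = 0` must deliver: res-L1-w42-stub-1 DESIGN CHECK 16:58:19Z, witness «one member with trace `V(xy)`»)
# (CRUX-PLAN w42 v3.13b/c (4); o1 `SurfacePrep.ofRecord` p543457; 067 `ReadyTSOfRecord` p542978; crux chain w42 `SigmaMaxModifications`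
# stmt-ResolutionOfSingularities-18506 / conjunct `SigmaMaxModificationsCorridor3` stmt-ResolutionOfSingularities-19249; helper of res-L1-w42-stub-1 (gen 5),
# `--supports stmt-…-19249 --as helper`, counted 0)

HONEST FRAMING. OURS bookkeeping over Literature `hasSNC_of_isRsopPart_labels` (`…StrictNormalCrossingsLabels`), `isSNCIdeal_iff_exists_isRsopPart`
(`…EtaleVanishingIdeal`), `IsRsopPart.exists_associated_of_prime_dvd_prod` (`…RsopMonomialIdeals`), `stalkIdeal_radical`, Mathlib `vanishingIdeal_support`, and this
seat's `surfaceSncLength_eq_zero_iff` (p544431). NOTHING here is a statement of H. Hironaka's manuscript [Hironaka2017] nor of [CossartJannsenSaito2020]; no named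
fact. AI-written; AI review is weaker than expert review.

THE POINT (design). `ℓ(E, D) = 0` says the UNION `S(E, D)` of the filtered traces is an snc divisor AS A SET; READINESS (`ReadyTSOfRecord` = regular ∧ `HasSNC` of the
trace LIST ∧ no repeated trace) asks MORE: at each point ONE regular parameter per member. The gap is exactly: (a) a trace that is not reduced, (b) a trace with two
branches through one point (of the SAME member — e.g. `V(xy)`: set-snc, multiplicity-free, yet not list-snc), (c) two members sharing a branch. Conditions
`hprin` («every stalk of every trace at a point of its support is generated by a PRIME element» — kills (a) and (b)) and `hdist` («distinct members have distinct
stalks where both pass» — kills (c)) are what a badness count with `M = 0` must certify; under them `ℓ = 0 ⇒ READY`.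

## Contents (namespace `…Theorems.SigmaMaxModificationsCorridor3.Sigma`)

* **`hasSNC_of_isStrictNormalCrossingsDivisor_divisorSet`** — on a scheme with regular local rings, a list `Γs` of ideal sheaves with prime principal stalks
  on their supports and pairwise distinct stalks at common points, whose divisor set `⋃ supp Γ` is a strict normal crossings divisor, HAS SIMPLE NORMAL CROSSINGS
  (`HasSNC Γs`): at `x ∈ S` the set-snc rsop part `z` with `𝓘(S)_x = (∏ zᵢ)` labels each member, because a prime generator `g` of `Γ_x ⊇ 𝓘(S)_x` divides `∏ zᵢ`,
  hence is associated with some `zᵢ`.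
* `Boundary.sncListOn_of_divisorSet_isSNC` (the filtered-trace reading), **`readyTSOfRecord_of_surfaceSncLength_eq_zero`** (`D̃` regular, traces prime-principal
  and stalk-distinct, no repeated trace, some resolving composition exists, `ℓ(E, D) = 0` ⇒ `ReadyTSOfRecord W E N ν D`).

VACUITY SELF-CHECK. `hprin` FAILS for the witness `V(xy)` (the stalk `(xy)` at the origin is principal but not prime) — that is the content of the design check; the
theorem is the positive half: with prime-principal, stalk-distinct, non-repeated traces, `ℓ = 0` is READY. Regularity of `D̃` off `S` is a genuine hypothesis
(`HasSNC` asks regular local rings everywhere).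
-/

noncomputable section

set_option linter.dupNamespace false -- mandated namespace of this single-conjunct summit

open CategoryTheory AlgebraicGeometry TopologicalSpace IsLocalRing
open Summit.ResolutionOfSingularities.ResolutionOfSingularities.Theorems.CampaignW42
open Literature.AlgebraicGeometry.Resolution Literature.RingTheory.HilbertSamuel

namespace Summit.ResolutionOfSingularities.ResolutionOfSingularities.Theorems.SigmaMaxModificationsCorridor3.Sigma

universe u

open Scheme.IdealSheafData

/-! ## List-level snc from set-level snc -/

section General

variable {D : Scheme.{u}}

/-- **LIST-LEVEL SNC FROM SET-LEVEL SNC.** On a scheme all of whose local rings are regular, let `Γs` be a list of ideal sheaves such that (1) at every point of its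
support each `Γ ∈ Γs` has stalk `(g)` with `g` PRIME («reduced with one branch»), (2) distinct members of `Γs` have distinct stalks at every common point («no shared
branch»), and (3) the union of the supports is a strict normal crossings divisor. Then `Γs` has simple normal crossings (Literature `HasSNC`: one regular parameter
per member through each point, distinct members distinct parameters). [folklore] -/
theorem hasSNC_of_isStrictNormalCrossingsDivisor_divisorSet (hreg : Scheme.IsRegular D) (Γs : Boundary D)
    (hprin : ∀ Γ ∈ Γs, ∀ x : D, x ∈ Γ.support → ∃ g : D.presheaf.stalk x, Prime g ∧ stalkIdeal Γ x = Ideal.span {g})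
    (hdist : ∀ Γ ∈ Γs, ∀ Γ' ∈ Γs, Γ ≠ Γ' → ∀ x : D, x ∈ Γ.support → x ∈ Γ'.support → stalkIdeal Γ x ≠ stalkIdeal Γ' x)
    (hS : IsStrictNormalCrossingsDivisor D Γs.divisorSet) : HasSNC Γs := by
  refine hasSNC_of_isRsopPart_labels Γs fun x => ?_
  by_cases hx : x ∈ Γs.divisorSet
  · -- the rsop part cutting out `S` at `x`
    obtain ⟨r, z, -, hz, hI⟩ := (isSNCIdeal_iff_exists_isRsopPart _).mp (hS.isStrictNormalCrossingsAt hx)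
    haveI := hz.isRegularLocalRing
    haveI := isDomain_of_isRegularLocalRing (D.presheaf.stalk x)
    -- every member through `x` is labelled by the parameter associated with its prime generator
    have key : ∀ D' : {Γ : D.IdealSheafData // Γ ∈ Γs ∧ x ∈ Γ.support}, ∃ i : Fin r, stalkIdeal D'.1 x = Ideal.span {z i} := by
      rintro ⟨Γ, hΓ, hxΓ⟩
      obtain ⟨g, hg, hΓx⟩ := hprin Γ hΓ x hxΓ
      -- `𝓘(S)_x ≤ √(Γ_x) = Γ_x`, i.e. `g ∣ ∏ zᵢ`
      have h1 : vanishingIdeal (⟨closure Γs.divisorSet, isClosed_closure⟩ : Closeds D) ≤ Γ.radical := by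
        rw [← Scheme.IdealSheafData.vanishingIdeal_support]
        refine Scheme.IdealSheafData.vanishingIdeal_antimono ?_
        intro y hy
        exact subset_closure (Boundary.mem_divisorSet_iff.mpr ⟨Γ, hΓ, hy⟩)
      have h2 : Ideal.span {∏ i, z i} ≤ Ideal.span {g} := by
        rw [← hI, ← (Ideal.span_singleton_prime hg.ne_zero).mpr hg |>.radical, ← hΓx, ← stalkIdeal_radical]
        exact stalkIdeal_mono h1 x
      obtain ⟨i, hi⟩ := hz.exists_associated_of_prime_dvd_prod hg (Ideal.span_singleton_le_span_singleton.mp h2)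
      exact ⟨i, by rw [hΓx]; exact Ideal.span_singleton_eq_span_singleton.mpr hi⟩
    choose lab hlab using key
    refine ⟨r, z, hz, lab, ?_, hlab⟩
    intro D₁ D₂ h
    by_contra hne
    have hne' : D₁.1 ≠ D₂.1 := fun h' => hne (Subtype.ext h')
    exact hdist D₁.1 D₁.2.1 D₂.1 D₂.2.1 hne' x D₁.2.2 D₂.2.2 (by rw [hlab D₁, hlab D₂, h])
  · -- off `S`: no member passes through `x`; the empty rsop part in the regular local ring
    haveI : IsRegularLocalRing (D.presheaf.stalk x) := hreg x
    have hnone : ∀ D' : {Γ : D.IdealSheafData // Γ ∈ Γs ∧ x ∈ Γ.support}, False :=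
      fun D' => hx (Boundary.mem_divisorSet_iff.mpr ⟨D'.1, D'.2.1, D'.2.2⟩)
    obtain ⟨s, hs⟩ := exists_regularSystemOfParameters (R := D.presheaf.stalk x)
    refine ⟨0, Fin.elim0, ⟨inferInstance, (maximalIdeal (D.presheaf.stalk x)).spanFinrank, s, ?_, ?_⟩, fun D' => (hnone D').elim,
      fun D₁ => (hnone D₁).elim, fun D' => (hnone D').elim⟩
    · have h := IsRegularLocalRing.spanFinrank_maximalIdeal (R := D.presheaf.stalk x)
      rw [zero_add]
      exact_mod_cast h.symm
    · rw [Set.range_eq_empty Fin.elim0, Set.empty_union, hs]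

end General

/-! ## The surface reading: `ℓ = 0` ⇒ READY under prime-principal, stalk-distinct, non-repeated traces -/

section Surface

variable {W : Scheme.{u}} {E : Boundary W} {N : ℕ} {ν : ℕ → ℕ} {D : Closeds W}

/-- **`SncListOn` from set-snc of the filtered trace configuration** (filtered-trace reading of the general lemma). [folklore] -/
theorem Boundary.sncListOn_of_divisorSet_isSNC {DS : Scheme.{u}} {ι : DS ⟶ W} (hreg : Scheme.IsRegular DS)
    (hprin : ∀ Γ ∈ E.restrictOff ι, ∀ x : DS, x ∈ Γ.support → ∃ g : DS.presheaf.stalk x, Prime g ∧ stalkIdeal Γ x = Ideal.span {g})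
    (hdist : ∀ Γ ∈ E.restrictOff ι, ∀ Γ' ∈ E.restrictOff ι, Γ ≠ Γ' → ∀ x : DS, x ∈ Γ.support → x ∈ Γ'.support → stalkIdeal Γ x ≠ stalkIdeal Γ' x)
    (hS : IsStrictNormalCrossingsDivisor DS (E.restrictOff ι).divisorSet) : E.SncListOn ι :=
  hasSNC_of_isStrictNormalCrossingsDivisor_divisorSet hreg _ hprin hdist hS

/-- **THE EXHAUSTIVENESS BRIDGE: `ℓ(E, D) = 0` ⇒ READY-TS**, provided the reduced surface `D̃` is regular, every filtered trace has PRIME principal stalks on its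
support, distinct traces have distinct stalks at common points, no trace is repeated, and some resolving composition exists (so that `ℓ = 0` means «`S(E, D)` is
snc», `surfaceSncLength_eq_zero_iff`). These side conditions are what the badness count's `M = 0` must certify for o1's case rule to be exhaustive. [folklore] -/
theorem readyTSOfRecord_of_surfaceSncLength_eq_zero (hreg : Scheme.IsRegular (menuCentre D).subscheme)
    (hprin : ∀ Γ ∈ E.restrictOff (menuCentre D).subschemeι, ∀ x : ↥(menuCentre D).subscheme, x ∈ Γ.support →
      ∃ g : (menuCentre D).subscheme.presheaf.stalk x, Prime g ∧ stalkIdeal Γ x = Ideal.span {g})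
    (hdist : ∀ Γ ∈ E.restrictOff (menuCentre D).subschemeι, ∀ Γ' ∈ E.restrictOff (menuCentre D).subschemeι, Γ ≠ Γ' →
      ∀ x : ↥(menuCentre D).subscheme, x ∈ Γ.support → x ∈ Γ'.support → stalkIdeal Γ x ≠ stalkIdeal Γ' x)
    (hnodup : (E.restrictOff (menuCentre D).subschemeι).Nodup)
    (hex : ∃ n, ExistsPointCompositionN (surfaceTraceSet E D) (ResolvesToSnc (surfaceTraceSet E D)) n) (hℓ : surfaceSncLength E D = 0) :
    ReadyTSOfRecord W E N ν D := by
  have hS : IsStrictNormalCrossingsDivisor (menuCentre D).subscheme (surfaceTraceSet E D) := (surfaceSncLength_eq_zero_iff hex).mp hℓ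
  exact ⟨⟨hreg, Boundary.sncListOn_of_divisorSet_isSNC hreg hprin hdist hS⟩, hnodup⟩

end Surface

end Summit.ResolutionOfSingularities.ResolutionOfSingularities.Theorems.SigmaMaxModificationsCorridor3.Sigma

end
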